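import Summits.RiemannHypothesis.RiemannHypothesis.Theorems.SuzukiKernelThetaDeriv

/-!
# The `θ`-flow on the window: `∂_θ 𝖪_θ[t]f = 𝒥_θ[t]f` and `∂_θ ‖𝖪_θ[t]f‖² = 2⟨𝒥_θ[t]f, 𝖪_θ[t]f⟩` (column DBR; RH-FREE)

RH-FREE throughout; nothing here bears on the truth of RH.

Operator-level half of the kernel flow `∂_θ K_θ = J_θ` of `Theorems.SuzukiKernelThetaDeriv` (`hasDerivAt_limKernel`;
`J_θ(x) = Re (2π)⁻¹∫_{Im z=1} L(z)Θ_θ(z)e^{−izx} dz`, `L = −2ξ'/ξ(½ − i·)`), for the truncated Hankel operators of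
[Su20] (1.4) on the window `(−t,t)` — the objects `winOp (limKernel θ) t f`, `winNormSq (limKernel θ) t f` of the
cell's crux idea `theta-flow-weil-window` (rh-dbr-idea-2, Sketch §T0), written out as set integrals:

* `exists_uniform_kernel_flow_bound` — locally uniformly in `θ' ∈ (θ−δ, θ+δ)` (`δ = (θ−1)/2`):
  `|K_θ'(x)| ≤ B eˣ` and `|J_θ'(x)| ≤ B eˣ` for all real `x`;
* `continuous_flowKernel` — `J_θ` is continuous (`θ > 1`);
* `hasDerivAt_winOp` — for `f ∈ L¹(−t,t)` and every `x`:
  `∂_θ ∫_{(−t,t)} K_θ(x+y) f(y) dy = ∫_{(−t,t)} J_θ(x+y) f(y) dy`;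
* **`hasDerivAt_winNormSq`** — for `f ∈ L¹(−t,t)`:
  `∂_θ ∫_{(−t,t)} (∫_{(−t,t)} K_θ(x+y)f(y)dy)² dx = ∫_{(−t,t)} 2 (∫ K_θ(x+y)f(y)dy)(∫ J_θ(x+y)f(y)dy) dx`.

What remains of idea-2's (T0) `ThetaFlowIdentity` after this file is the PAIRING identity
`2⟨𝒥_θ[t]f, 𝖪_θ[t]f⟩ = −2·Re weilQuadratic(𝖪_θ[t]f · 𝟙_{(−t,t)})` (explicit-formula bookkeeping in the tree's
normalisation of `weilFunctional`), not attempted here.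

References: [Su20] M. Suzuki, ASPM 84 (2020) = arXiv:1907.07302, (1.4), (1.9), Thm 1.2.
-/

noncomputable section

-- D-0017: `Summit.<S>.<S>.…` is the designed namespace of a single-problem summit.
set_option linter.dupNamespace false

open Complex MeasureTheory Filter Topology Set Metric

namespace Summit.RiemannHypothesis.RiemannHypothesis.Theorems.SuzukiKernelSemigroup

open Literature.NumberTheory.LFunctions

/-! ## §1 Locally uniform exponential bounds for `K_θ` and `J_θ` -/

/-- RH-FREE.  The integrand of the flow kernel is integrable along `Im z = 1` with the trivial phase (`x = 0` form):
`u ↦ ‖L(u+i) Θ_θ(u+i)‖` is integrable for `θ > 1`. -/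
theorem integrable_norm_flowSymbol_mul_limTheta {θ : ℝ} (hθ : 1 < θ) :
    Integrable fun u : ℝ => ‖-2 * logDeriv riemannXi (1 / 2 - I * ((u : ℂ) + ((1 : ℝ) : ℂ) * I)) *
      limTheta θ ((u : ℂ) + ((1 : ℝ) : ℂ) * I)‖ := by
  have h := ((hasDerivAt_lineIntegral_limTheta hθ 0).1).norm
  refine h.congr (Eventually.of_forall fun u => ?_)
  simp only [norm_mul, norm_cexp_line_one, Real.exp_zero, mul_one]

/-- **RH-FREE · locally uniform bounds**: for `θ > 1`, with `δ = (θ−1)/2`, there is `B ≥ 0` such that for every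
`θ'` with `|θ' − θ| < δ` and every real `x`: `|K_θ'(x)| ≤ B eˣ` and `|J_θ'(x)| ≤ B eˣ`
(`J_θ' = Re invFourierLine (L·Θ_θ') 1`; majorants `(C₁+C₂)(1+|u|)^{−θ₁}` and
`2(C + 2/(θ₁−1))(C₁+C₂)(1+|u|)^{−(θ₁+1)/2}` along the line, `θ₁ = θ − δ`). -/
theorem exists_uniform_kernel_flow_bound {θ : ℝ} (hθ : 1 < θ) :
    ∃ B : ℝ, 0 ≤ B ∧ ∀ θ' ∈ ball θ ((θ - 1) / 2), ∀ x : ℝ,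
      |limKernel θ' x| ≤ B * Real.exp x ∧
      |(invFourierLine (fun z : ℂ => -2 * logDeriv riemannXi (1 / 2 - I * z) * limTheta θ' z) 1 x).re| ≤
        B * Real.exp x := by
  set δ : ℝ := (θ - 1) / 2 with hδ
  set θ₁ : ℝ := θ - δ with hθ₁
  set θ₂ : ℝ := θ + δ with hθ₂
  have hθ₁1 : 1 < θ₁ := by rw [hθ₁, hδ]; linarith
  obtain ⟨C, hC0, hC⟩ := norm_flowSymbol_line_le
  obtain ⟨C₁, hC₁0, hC₁⟩ := norm_limTheta_line_le (θ := θ₁) (by linarith) (b₀ := 1) (by norm_num)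
  obtain ⟨C₂, hC₂0, hC₂⟩ := norm_limTheta_line_le (θ := θ₂) (by rw [hθ₂]; linarith) (b₀ := 1) (by norm_num)
  set r : ℝ := θ₁ - (θ₁ - 1) / 2 with hr
  have hr1 : 1 < r := by rw [hr]; linarith
  -- the two majorants along the line
  set m₁ : ℝ → ℝ := fun u => (C₁ + C₂) * (1 + |u|) ^ (-θ₁) with hm₁
  set m₂ : ℝ → ℝ := fun u => 2 * ((C + 1 / ((θ₁ - 1) / 2)) * (1 + |u|) ^ (-r)) * (C₁ + C₂) with hm₂
  have hm₁i : Integrable m₁ := (integrable_one_add_abs_rpow_neg' hθ₁1).const_mul _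
  have hm₂i : Integrable m₂ := (((integrable_one_add_abs_rpow_neg' hr1).const_mul _).const_mul 2).mul_const _
  set I₁ : ℝ := ∫ u, m₁ u with hI₁
  set I₂ : ℝ := ∫ u, m₂ u with hI₂
  have hI₁0 : 0 ≤ I₁ := integral_nonneg fun u => by positivity
  have hI₂0 : 0 ≤ I₂ := integral_nonneg fun u => by positivity
  refine ⟨1 / (2 * Real.pi) * (I₁ + I₂), by positivity, fun θ' hθ' x => ?_⟩
  have hθ'1 : θ₁ ≤ θ' := by
    have := (abs_lt.1 (mem_ball.1 hθ')).1; rw [hθ₁]; linarith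
  have hθ'2 : θ' ≤ θ₂ := by
    have := (abs_lt.1 (mem_ball.1 hθ')).2; rw [hθ₂]; linarith
  have hθ'gt : 1 < θ' := lt_of_lt_of_le hθ₁1 hθ'1
  -- pointwise symbol bounds on the line
  have hΘ : ∀ u : ℝ, ‖limTheta θ' ((u : ℂ) + ((1 : ℝ) : ℂ) * I)‖ ≤ m₁ u := by
    intro u
    have hy0 : 0 < 1 + |u| := by linarith [abs_nonneg u]
    refine (norm_limTheta_le_add hθ'1 hθ'2 _).trans ?_
    have e1 := hC₁ 1 le_rfl u
    have e2 := hC₂ 1 le_rfl u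
    have hmono : (1 + |u|) ^ (-θ₂) ≤ (1 + |u|) ^ (-θ₁) :=
      Real.rpow_le_rpow_of_exponent_le (by linarith [abs_nonneg u]) (by rw [hθ₁, hθ₂]; linarith)
    rw [hm₁]
    nlinarith [Real.rpow_nonneg hy0.le (-θ₁)]
  have hLΘ : ∀ u : ℝ, ‖-2 * logDeriv riemannXi (1 / 2 - I * ((u : ℂ) + ((1 : ℝ) : ℂ) * I)) *
      limTheta θ' ((u : ℂ) + ((1 : ℝ) : ℂ) * I)‖ ≤ m₂ u := by
    intro u
    have hy0 : 0 < 1 + |u| := by linarith [abs_nonneg u]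
    rw [norm_mul, hm₂]
    have hLu := hC u
    have hlog := log_mul_rpow_le hC0 hθ₁1 u
    have hlog0 : 0 ≤ Real.log (1 + |u|) := Real.log_nonneg (by linarith [abs_nonneg u])
    calc ‖-2 * logDeriv riemannXi (1 / 2 - I * ((u : ℂ) + ((1 : ℝ) : ℂ) * I))‖ *
          ‖limTheta θ' ((u : ℂ) + ((1 : ℝ) : ℂ) * I)‖
        ≤ (2 * (C + Real.log (1 + |u|))) * m₁ u := by
          gcongr
          · exact (hΘ u)
      _ = 2 * ((C + Real.log (1 + |u|)) * (1 + |u|) ^ (-θ₁)) * (C₁ + C₂) := by rw [hm₁]; ring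
      _ ≤ 2 * ((C + 1 / ((θ₁ - 1) / 2)) * (1 + |u|) ^ (-r)) * (C₁ + C₂) := by rw [hr]; gcongr
  -- integrals of the norms along the line
  have hint₁ : ∫ u : ℝ, ‖limTheta θ' ((u : ℂ) + ((1 : ℝ) : ℂ) * I)‖ ≤ I₁ :=
    integral_mono (integrable_limTheta_line hθ'gt (b := 1) (by norm_num)).norm hm₁i hΘ
  have hint₂ : ∫ u : ℝ, ‖-2 * logDeriv riemannXi (1 / 2 - I * ((u : ℂ) + ((1 : ℝ) : ℂ) * I)) *
      limTheta θ' ((u : ℂ) + ((1 : ℝ) : ℂ) * I)‖ ≤ I₂ :=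
    integral_mono (integrable_norm_flowSymbol_mul_limTheta hθ'gt) hm₂i hLΘ
  have hπ : 0 < 1 / (2 * Real.pi) := by positivity
  constructor
  · -- the kernel
    have h1 : |limKernel θ' x| ≤ ‖invFourierLine (limTheta θ') 1 x‖ := Complex.abs_re_le_norm _
    have h2 := norm_invFourierLine_le (limTheta θ') 1 x
    rw [one_mul] at h2
    calc |limKernel θ' x| ≤ 1 / (2 * Real.pi) * Real.exp x * I₁ := by
          refine h1.trans (h2.trans ?_)
          exact mul_le_mul_of_nonneg_left hint₁ (by positivity)
      _ ≤ 1 / (2 * Real.pi) * (I₁ + I₂) * Real.exp x := by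
          nlinarith [mul_nonneg (mul_nonneg hπ.le (Real.exp_pos x).le) hI₂0]
  · -- the flow kernel
    have h1 : |(invFourierLine (fun z : ℂ => -2 * logDeriv riemannXi (1 / 2 - I * z) * limTheta θ' z) 1 x).re| ≤
        ‖invFourierLine (fun z : ℂ => -2 * logDeriv riemannXi (1 / 2 - I * z) * limTheta θ' z) 1 x‖ :=
      Complex.abs_re_le_norm _
    have h2 := norm_invFourierLine_le (fun z : ℂ => -2 * logDeriv riemannXi (1 / 2 - I * z) * limTheta θ' z) 1 x
    rw [one_mul] at h2
    calc |(invFourierLine (fun z : ℂ => -2 * logDeriv riemannXi (1 / 2 - I * z) * limTheta θ' z) 1 x).re|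
        ≤ 1 / (2 * Real.pi) * Real.exp x * I₂ := by
          refine h1.trans (h2.trans ?_)
          exact mul_le_mul_of_nonneg_left hint₂ (by positivity)
      _ ≤ 1 / (2 * Real.pi) * (I₁ + I₂) * Real.exp x := by
          nlinarith [mul_nonneg (mul_nonneg hπ.le (Real.exp_pos x).le) hI₁0]

/-- RH-FREE.  The flow kernel `J_θ = Re invFourierLine (L·Θ_θ) 1` is continuous (`θ > 1`). -/
theorem continuous_flowKernel {θ : ℝ} (hθ : 1 < θ) :
    Continuous fun x : ℝ =>
      (invFourierLine (fun z : ℂ => -2 * logDeriv riemannXi (1 / 2 - I * z) * limTheta θ z) 1 x).re := by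
  have h : Continuous fun x : ℝ =>
      invFourierLine (fun z : ℂ => -2 * logDeriv riemannXi (1 / 2 - I * z) * limTheta θ z) 1 x :=
    continuous_invFourierLine zero_le_one fun x => (hasDerivAt_lineIntegral_limTheta hθ x).1
  exact Complex.continuous_re.comp h

/-! ## §2 `∂_θ (𝖪_θ[t] f)(x) = (𝒥_θ[t] f)(x)` -/

/-- **RH-FREE · the flow of the window transform, pointwise**: for `θ > 1`, `f` integrable on `(−t,t)` and every
real `x`, `θ' ↦ ∫_{(−t,t)} K_θ'(x+y) f(y) dy` has derivative `∫_{(−t,t)} J_θ(x+y) f(y) dy` at `θ`. -/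
theorem hasDerivAt_winOp {θ t : ℝ} (hθ : 1 < θ) {f : ℝ → ℝ} (hf : Integrable f (volume.restrict (Ioo (-t) t)))
    (x : ℝ) :
    HasDerivAt (fun θ' : ℝ => ∫ y in Ioo (-t) t, limKernel θ' (x + y) * f y)
      (∫ y in Ioo (-t) t,
        (invFourierLine (fun z : ℂ => -2 * logDeriv riemannXi (1 / 2 - I * z) * limTheta θ z) 1 (x + y)).re * f y)
      θ := by
  obtain ⟨B, hB0, hB⟩ := exists_uniform_kernel_flow_bound hθ
  set δ : ℝ := (θ - 1) / 2 with hδ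
  have hδ0 : 0 < δ := by rw [hδ]; linarith
  set μ : Measure ℝ := volume.restrict (Ioo (-t) t) with hμ
  set J : ℝ → ℝ → ℝ := fun θ' u =>
    (invFourierLine (fun z : ℂ => -2 * logDeriv riemannXi (1 / 2 - I * z) * limTheta θ' z) 1 u).re with hJ
  have hθ'gt : ∀ θ' ∈ ball θ δ, 1 < θ' := fun θ' hθ' => by
    have := (abs_lt.1 (mem_ball.1 hθ')).1; rw [hδ] at this; linarith
  -- measurability
  have hF_meas : ∀ θ' ∈ ball θ δ, AEStronglyMeasurable (fun y : ℝ => limKernel θ' (x + y) * f y) μ :=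
    fun θ' hθ' => (((Suzuki2020_thm12_continuous (hθ'gt θ' hθ')).comp
      (continuous_const.add continuous_id)).aestronglyMeasurable).mul hf.aestronglyMeasurable
  have hF'_meas : AEStronglyMeasurable (fun y : ℝ => J θ (x + y) * f y) μ :=
    (((continuous_flowKernel hθ).comp (continuous_const.add continuous_id)).aestronglyMeasurable).mul hf.aestronglyMeasurable
  -- integrability at θ: bounded kernel × integrable f on the window
  have hF_int : Integrable (fun y : ℝ => limKernel θ (x + y) * f y) μ := by
    refine ((hf.norm.const_mul (B * Real.exp (x + t))).mono' (hF_meas θ (mem_ball_self hδ0))) ?_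
    refine (ae_restrict_mem measurableSet_Ioo).mono fun y hy => ?_
    rw [norm_mul, Real.norm_eq_abs]
    have h1 := (hB θ (mem_ball_self hδ0) (x + y)).1
    have h2 : Real.exp (x + y) ≤ Real.exp (x + t) := Real.exp_le_exp.2 (by linarith [hy.2])
    have : |limKernel θ (x + y)| ≤ B * Real.exp (x + t) := h1.trans (by nlinarith)
    exact mul_le_mul_of_nonneg_right this (norm_nonneg _)
  -- the bound on the derivative integrand, uniformly on the ball
  have h_bound : ∀ᵐ y ∂μ, ∀ θ' ∈ ball θ δ, ‖J θ' (x + y) * f y‖ ≤ B * Real.exp (x + t) * ‖f y‖ := by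
    refine (ae_restrict_mem measurableSet_Ioo).mono fun y hy θ' hθ' => ?_
    rw [norm_mul, Real.norm_eq_abs]
    have h1 := (hB θ' hθ' (x + y)).2
    have h2 : Real.exp (x + y) ≤ Real.exp (x + t) := Real.exp_le_exp.2 (by linarith [hy.2])
    have : |J θ' (x + y)| ≤ B * Real.exp (x + t) := h1.trans (by nlinarith)
    exact mul_le_mul_of_nonneg_right this (norm_nonneg _)
  have hbound_int : Integrable (fun y : ℝ => B * Real.exp (x + t) * ‖f y‖) μ := hf.norm.const_mul _
  -- pointwise differentiability
  have h_diff : ∀ᵐ y ∂μ, ∀ θ' ∈ ball θ δ,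
      HasDerivAt (fun θ'' : ℝ => limKernel θ'' (x + y) * f y) (J θ' (x + y) * f y) θ' :=
    Eventually.of_forall fun y θ' hθ' => (hasDerivAt_limKernel (hθ'gt θ' hθ') (x + y)).mul_const (f y)
  have hmain := hasDerivAt_integral_of_dominated_loc_of_deriv_le (ball_mem_nhds θ hδ0)
    (eventually_of_mem (ball_mem_nhds θ hδ0) hF_meas) hF_int hF'_meas h_bound hbound_int h_diff
  exact hmain.2

/-! ## §3 `∂_θ ‖𝖪_θ[t] f‖² = 2⟨𝖪_θ[t] f, 𝒥_θ[t] f⟩` -/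

/-- **RH-FREE · the flow of the squared window norm**: for `θ > 1` and `f` integrable on `(−t,t)`,
`θ' ↦ ∫_{(−t,t)} (∫_{(−t,t)} K_θ'(x+y)f(y)dy)² dx` has derivative
`∫_{(−t,t)} 2 (∫_{(−t,t)} K_θ(x+y)f(y)dy)(∫_{(−t,t)} J_θ(x+y)f(y)dy) dx` at `θ` — `d/dθ ‖𝖪_θ[t]f‖² = 2⟨𝖪_θ[t]f, 𝒥_θ[t]f⟩`,
the left side of idea-2's (T0) `ThetaFlowIdentity` (`winNormSq (limKernel θ) t f` written out). -/
theorem hasDerivAt_winNormSq {θ t : ℝ} (hθ : 1 < θ) {f : ℝ → ℝ} (hf : Integrable f (volume.restrict (Ioo (-t) t))) :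
    HasDerivAt (fun θ' : ℝ => ∫ x in Ioo (-t) t, (∫ y in Ioo (-t) t, limKernel θ' (x + y) * f y) ^ 2)
      (∫ x in Ioo (-t) t, 2 * (∫ y in Ioo (-t) t, limKernel θ (x + y) * f y) *
        (∫ y in Ioo (-t) t,
          (invFourierLine (fun z : ℂ => -2 * logDeriv riemannXi (1 / 2 - I * z) * limTheta θ z) 1 (x + y)).re *
            f y)) θ := by
  obtain ⟨B, hB0, hB⟩ := exists_uniform_kernel_flow_bound hθ
  set δ : ℝ := (θ - 1) / 2 with hδ
  have hδ0 : 0 < δ := by rw [hδ]; linarith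
  set μ : Measure ℝ := volume.restrict (Ioo (-t) t) with hμ
  haveI : IsFiniteMeasure μ := by rw [hμ]; infer_instance
  set J : ℝ → ℝ → ℝ := fun θ' u =>
    (invFourierLine (fun z : ℂ => -2 * logDeriv riemannXi (1 / 2 - I * z) * limTheta θ' z) 1 u).re with hJ
  set h : ℝ → ℝ → ℝ := fun θ' x => ∫ y in Ioo (-t) t, limKernel θ' (x + y) * f y with hh
  set h' : ℝ → ℝ → ℝ := fun θ' x => ∫ y in Ioo (-t) t, J θ' (x + y) * f y with hh'
  have hθ'gt : ∀ θ' ∈ ball θ δ, 1 < θ' := fun θ' hθ' => by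
    have := (abs_lt.1 (mem_ball.1 hθ')).1; rw [hδ] at this; linarith
  set N : ℝ := ∫ y in Ioo (-t) t, ‖f y‖ with hN
  have hN0 : 0 ≤ N := integral_nonneg fun y => norm_nonneg _
  -- uniform bounds on `h` and `h'` on the window, for `θ'` in the ball
  have hbd : ∀ θ' ∈ ball θ δ, ∀ x : ℝ, x < t →
      |h θ' x| ≤ B * Real.exp (2 * t) * N ∧ |h' θ' x| ≤ B * Real.exp (2 * t) * N := by
    intro θ' hθ' x hx
    have key : ∀ (G : ℝ → ℝ), (∀ u, |G u| ≤ B * Real.exp u) →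
        |∫ y in Ioo (-t) t, G (x + y) * f y| ≤ B * Real.exp (2 * t) * N := by
      intro G hG
      rw [hN, ← integral_const_mul]
      refine (Real.norm_eq_abs _).symm.le.trans (norm_integral_le_of_norm_le (hf.norm.const_mul _) ?_)
      refine (ae_restrict_mem measurableSet_Ioo).mono fun y hy => ?_
      rw [norm_mul, Real.norm_eq_abs]
      have h1 := hG (x + y)
      have h2 : Real.exp (x + y) ≤ Real.exp (2 * t) := Real.exp_le_exp.2 (by linarith [hy.2])
      have : |G (x + y)| ≤ B * Real.exp (2 * t) := h1.trans (by nlinarith)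
      exact mul_le_mul_of_nonneg_right this (norm_nonneg _)
    exact ⟨key _ fun u => (hB θ' hθ' u).1, key _ fun u => (hB θ' hθ' u).2⟩
  -- measurability of `x ↦ h θ' x` and `x ↦ h' θ x` on the window (Fubini measurability)
  have hmeas_gen : ∀ (G : ℝ → ℝ), Continuous G →
      AEStronglyMeasurable (fun x : ℝ => ∫ y in Ioo (-t) t, G (x + y) * f y) μ := by
    intro G hG
    have hm : AEStronglyMeasurable (Function.uncurry fun x y : ℝ => G (x + y) * f y) (μ.prod μ) :=
      ((hG.comp continuous_add).aestronglyMeasurable).mul hf.aestronglyMeasurable.comp_snd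
    exact hm.integral_prod_right'
  have hF_meas : ∀ θ' ∈ ball θ δ, AEStronglyMeasurable (fun x : ℝ => (h θ' x) ^ 2) μ := fun θ' hθ' =>
    (hmeas_gen _ (Suzuki2020_thm12_continuous (hθ'gt θ' hθ'))).pow 2
  have hF'_meas : AEStronglyMeasurable (fun x : ℝ => 2 * h θ x * h' θ x) μ :=
    ((hmeas_gen _ (Suzuki2020_thm12_continuous hθ)).const_mul 2).mul (hmeas_gen _ (continuous_flowKernel hθ))
  -- integrability of `h θ ^ 2` (bounded on a finite measure)
  set M : ℝ := B * Real.exp (2 * t) * N with hM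
  have hM0 : 0 ≤ M := by positivity
  have hF_int : Integrable (fun x : ℝ => (h θ x) ^ 2) μ := by
    refine (integrable_const (M ^ 2)).mono' (hF_meas θ (mem_ball_self hδ0)) ?_
    refine (ae_restrict_mem measurableSet_Ioo).mono fun x hx => ?_
    have hb := (hbd θ (mem_ball_self hδ0) x hx.2).1
    rw [Real.norm_eq_abs, abs_pow]
    exact pow_le_pow_left₀ (abs_nonneg _) hb 2
  have h_bound : ∀ᵐ x ∂μ, ∀ θ' ∈ ball θ δ, ‖2 * h θ' x * h' θ' x‖ ≤ 2 * M * M := by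
    refine (ae_restrict_mem measurableSet_Ioo).mono fun x hx θ' hθ' => ?_
    obtain ⟨b1, b2⟩ := hbd θ' hθ' x hx.2
    rw [Real.norm_eq_abs, abs_mul, abs_mul, abs_two]
    have := mul_le_mul b1 b2 (abs_nonneg _) hM0
    nlinarith
  have h_diff : ∀ᵐ x ∂μ, ∀ θ' ∈ ball θ δ,
      HasDerivAt (fun θ'' : ℝ => (h θ'' x) ^ 2) (2 * h θ' x * h' θ' x) θ' := by
    refine Eventually.of_forall fun x θ' hθ' => ?_
    have hd : HasDerivAt (fun θ'' : ℝ => h θ'' x) (h' θ' x) θ' :=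
      hasDerivAt_winOp (hθ'gt θ' hθ') hf x
    have hm : HasDerivAt (fun θ'' : ℝ => h θ'' x * h θ'' x) (h' θ' x * h θ' x + h θ' x * h' θ' x) θ' :=
      hd.mul hd
    have e : (fun θ'' : ℝ => (h θ'' x) ^ 2) = fun θ'' : ℝ => h θ'' x * h θ'' x := funext fun _ => sq _
    rw [e]
    exact hm.congr_deriv (by ring)
  have hmain := hasDerivAt_integral_of_dominated_loc_of_deriv_le (ball_mem_nhds θ hδ0)
    (eventually_of_mem (ball_mem_nhds θ hδ0) hF_meas) hF_int hF'_meas h_bound (integrable_const _) h_diff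
  exact hmain.2

end Summit.RiemannHypothesis.RiemannHypothesis.Theorems.SuzukiKernelSemigroup

end
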